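import Mathlib.RingTheory.MvPolynomial.Homogeneous
import Mathlib.LinearAlgebra.FiniteDimensional.Lemmas
import Mathlib.LinearAlgebra.Dimension.Constructions
import Mathlib.Algebra.Polynomial.Lifts
import Mathlib.Data.Finsupp.Fin
import Literature.Barriers.Schanuel.EFunctionValuesAtAlgebraicPointsProducts
import Literature.Barriers.Schanuel.EFunctionValuesAtAlgebraicPointsCoeffField
import Literature.Barriers.Schanuel.SiegelShidlovskiiRank
import HarnessLib

/-!
# Barrier (Schanuel) `EFunctionValuesAtAlgebraicPoints`: Siegel–Shidlovskii (Thm. 5.10) from the rank theorem (Thm. 5.20) — proofs only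

`Literature/Barriers/Schanuel/EFunctionValuesAtAlgebraicPointsReduction.lean` — sibling file of
`EFunctionValuesAtAlgebraicPoints.lean` in the programme to discharge `siegelShidlovskii_algIndep`
(Siegel–Shidlovskii; Rivoal Thm. 5.10). It PROVES the reduction printed on pp. 240–241 of
[Rivoal2024]: "Ce dernier énoncé [Théorème 5.20] suffit toutefois pour démontrer ce que l'on veut
grâce à l'astuce de Siegel … une relation polynomiale sur `ℚ̄(z)` entre des `E`-fonctions
`F₁(z), …, Fₙ(z)` n'est rien d'autre qu'une relation linéaire sur `ℚ̄(z)` entre les diverses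
`E`-fonctions que l'on obtient en faisant des produits des `Fⱼ(z)`. Après un travail assez
technique, on ramène alors la démonstration du théorème 5.10 à une application du théorème 5.20"
— as the theorem

  `siegelShidlovskii_algIndep_of_rankBound : shidlovskii_rankBound → siegelShidlovskii_algIndep`

and, more generally, `siegelShidlovskii_algIndep_of_rankBoundWith C : rankBoundWith C → …` for
the rank bound `#ι ≤ C(K) · rank_K{Fᵢ(α)}` with ANY constant `C(K)` depending only on the number
field (Baker's §4 uses a cruder constant than Rivoal's `[K:ℚ]`). So the named fact
`siegelShidlovskii_algIndep` (= the catalogue declaration) now rests on the single analytic named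
fact `shidlovskii_rankBound` (`SiegelShidlovskiiRank.lean`, Rivoal Thm. 5.20 = Shidlovskii's
Lemma 17 = Baker Ch. 11 Lemmas 1–4 + the size/determinant estimate of §4): TO DISCHARGE IT, IT
SUFFICES TO PROVE `shidlovskii_rankBound` OR ANY `rankBoundWith C`.

## The argument (Siegel 1929 / Shidlovskii; Rivoal pp. 240–241, Baker Ch. 11 p. 114)

Let `F₁, …, Fₙ` be strict `E`-functions with `T Fᵢ′ = ∑ Bᵢⱼ Fⱼ`, `(z, F₁, …, Fₙ)` algebraically
independent over `ℚ̄`, `α ∈ ℚ̄`, `αT(α) ≠ 0`, and suppose `P(F₁(α), …, Fₙ(α)) = 0` for some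
`P ≠ 0` of degree `d`. Everything is defined over ONE number field `K` (`…CoeffField.lean`:
coefficients of the `Fᵢ`; plus `α`, the coefficients of `T, B, P`), `[K:ℚ] = κ`.
For each `m`, the degree-`m` monomials `G^μ` in `G = (1, F₁, …, Fₙ)` (`#MonIdx n m = (n+m choose m)`
of them) are strict `E`-functions over `K` solving a linear system with the same `T`
(`…Products.lean`: `emon_system` + cyclic-vector lemma), `K[z]`-linearly independent
(`emon_linIndep_of_algebraicIndependent`, from the algebraic independence); Théorème 5.20 gives
`(n+m choose m) ≤ κ · rank_K {G^μ(α)}`. But `{G^μ(α)}` is the image of the degree-`m` part of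
`K[X₀, …, Xₙ]` under evaluation at `(1, F(α))`, whose kernel contains `P^h · K[X]_{m-d}`
(`P^h` the homogenisation), so `rank_K ≤ (n+m choose m) - (n+m-d choose m-d)`
(`finrank_span_monVal_add_card_le`). Since `(n+m-d choose m-d)/(n+m choose m) → 1`
(`choose_counting`), this is absurd for `m` large.

## References

* [Rivoal2024] T. Rivoal, *Les E-fonctions et G-fonctions de Siegel*, Journées X-UPS 2019
  (2024), doi:10.5802/xups.2019-03: Théorèmes 5.10, 5.20, 5.21, §5.3 pp. 240–241.
* A. Baker, *Transcendental Number Theory* (1975), Ch. 11, p. 114 — cited through [Rivoal2024].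
-/

noncomputable section

open Complex Polynomial Finset
open scoped Nat

namespace Literature.Barriers.Schanuel

-- `ℚ`-algebra diamond on subfields of `ℂ`: see `EFunctionValuesAtAlgebraicPointsArith.lean`.
attribute [-instance] DivisionRing.toRatAlgebra

/-! ### 1. `K[z]`-linear independence of the monomials from algebraic independence -/

section LinIndep

variable {n m : ℕ} {a : Fin n → ℕ → ℂ}

/-- The exponent vector of `zᵏ · F^{tail μ}` in `ℚ̄[X₀, …, Xₙ]`: `μ` with its `0`-th entry
replaced by `k`. [folklore] -/
def monExp (μ : Fin (n + 1) →₀ ℕ) (k : ℕ) : Fin (n + 1) →₀ ℕ :=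
  μ.update 0 k

/-- `monExp μ k 0 = k`. [folklore] -/
@[simp] theorem monExp_zero (μ : Fin (n + 1) →₀ ℕ) (k : ℕ) : monExp μ k 0 = k := by
  simp [monExp]

/-- `monExp μ k (i+1) = μ (i+1)`. [folklore] -/
@[simp] theorem monExp_succ (μ : Fin (n + 1) →₀ ℕ) (k : ℕ) (i : Fin n) :
    monExp μ k i.succ = μ i.succ := by
  simp [monExp]

/-- `monExp` is injective on `MonIdx n m × ℕ` (the `0`-th entry of `μ` is determined by the
others since `|μ| = m`). [folklore] -/
theorem monExp_inj {μ μ' : MonIdx n m} {k k' : ℕ} (h : monExp μ.1 k = monExp μ'.1 k') :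
    μ = μ' ∧ k = k' := by
  have hk : k = k' := by simpa using congrArg (fun ν => ν 0) h
  have htail : ∀ i : Fin n, μ.1 i.succ = μ'.1 i.succ := fun i => by
    simpa using congrArg (fun ν => ν i.succ) h
  refine ⟨Subtype.ext (Finsupp.ext fun i => ?_), hk⟩
  refine Fin.cases ?_ (fun i => htail i) i
  have h1 := μ.degree_eq
  have h2 := μ'.degree_eq
  rw [Finsupp.degree_eq_sum, Fin.sum_univ_succ] at h1 h2
  have : ∑ i : Fin n, μ.1 i.succ = ∑ i : Fin n, μ'.1 i.succ := sum_congr rfl fun i _ => htail i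
  omega

/-- **Linear independence of the monomials over `K[z]`.** If `(z, F₁, …, Fₙ)` are algebraically
independent over `ℚ̄` (Mathlib's `AlgebraicIndependent` in the algebra `ℂ → ℂ`), then the
degree-`m` monomials `G^μ` in `G = (1, F)` admit no non-trivial relation `∑ c_μ(z) G^μ(z) ≡ 0`
with `c_μ ∈ K[z]`, `K ⊆ ℚ̄` ("une relation polynomiale … n'est rien d'autre qu'une relation
linéaire … entre les … produits"). [cite: Rivoal2024, §5.3 p. 240] -/
theorem emon_linIndep_of_algebraicIndependent (ha : ∀ i, ExpBound (a i))
    (halg : AlgebraicIndependent (algebraicClosure ℚ ℂ)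
      (Fin.cons (id : ℂ → ℂ) fun i => eSeries (a i) : Fin (n + 1) → ℂ → ℂ))
    (K : IntermediateField ℚ ℂ) (hK : K ≤ algebraicClosure ℚ ℂ)
    (c : MonIdx n m → Polynomial ℂ) (hc : ∀ μ k, (c μ).coeff k ∈ K)
    (hrel : ∀ z, ∑ μ, (c μ).eval z * eSeries (emon a μ.1) z = 0) : c = 0 := by
  classical
  set Qb := algebraicClosure ℚ ℂ
  -- lifted coefficients and a degree bound
  set c' : MonIdx n m → ℕ → Qb := fun μ k => ⟨(c μ).coeff k, hK (hc μ k)⟩ with hc'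
  set D : ℕ := (univ.sup fun μ => (c μ).natDegree) + 1 with hDdef
  have hD : ∀ μ, (c μ).natDegree < D := fun μ =>
    Nat.lt_succ_of_le (le_sup (f := fun μ => (c μ).natDegree) (mem_univ μ))
  -- the polynomial `Q = ∑_{μ,k} c_{μ,k} X^{monExp μ k}`
  set Q : MvPolynomial (Fin (n + 1)) Qb :=
    ∑ μ, ∑ k ∈ range D, MvPolynomial.monomial (monExp μ.1 k) (c' μ k) with hQ
  set x : Fin (n + 1) → ℂ → ℂ := Fin.cons (id : ℂ → ℂ) fun i => eSeries (a i) with hx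
  -- evaluation of a monomial at `x`
  have hmon : ∀ (μ : MonIdx n m) (k : ℕ) (z : ℂ),
      MvPolynomial.aeval x (MvPolynomial.monomial (monExp μ.1 k) (c' μ k)) z =
        (c μ).coeff k * z ^ k * eSeries (emon a μ.1) z := by
    intro μ k z
    rw [MvPolynomial.aeval_monomial, Finsupp.prod_fintype _ _ (fun i => pow_zero _), Pi.mul_apply,
      Finset.prod_apply, Fin.prod_univ_succ, eSeries_emon_eq_prod ha]
    have h1 : (algebraMap Qb (ℂ → ℂ)) (c' μ k) z = (c μ).coeff k := rfl
    simp only [h1, Pi.pow_apply, monExp_zero, monExp_succ, hx, Fin.cons_zero, Fin.cons_succ, id]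
    ring
  have hQx : MvPolynomial.aeval x Q = 0 := by
    funext z
    rw [hQ, map_sum, Finset.sum_apply]
    simp only [map_sum, Finset.sum_apply, hmon, Pi.zero_apply]
    rw [← hrel z]
    refine sum_congr rfl fun μ _ => ?_
    rw [eval_eq_sum_range' (hD μ), sum_mul]
  have hQ0 : Q = 0 := halg (by rw [hQx, map_zero])
  -- extract the coefficients
  funext μ
  refine Polynomial.ext fun k => ?_
  rw [Pi.zero_apply, coeff_zero]
  by_cases hk : k < D
  · have hcoeff : MvPolynomial.coeff (monExp μ.1 k) Q = c' μ k := by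
      rw [hQ, MvPolynomial.coeff_sum, Finset.sum_eq_single μ]
      · rw [MvPolynomial.coeff_sum, Finset.sum_eq_single k]
        · rw [MvPolynomial.coeff_monomial, if_pos rfl]
        · intro k' _ hk'
          rw [MvPolynomial.coeff_monomial, if_neg]
          intro h
          exact hk' (monExp_inj h).2
        · intro h
          exact (h (mem_range.mpr hk)).elim
      · intro μ' _ hμ'
        rw [MvPolynomial.coeff_sum]
        refine Finset.sum_eq_zero fun k' _ => ?_
        rw [MvPolynomial.coeff_monomial, if_neg]
        intro h
        exact hμ' (monExp_inj h).1
      · intro h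
        exact (h (mem_univ μ)).elim
    rw [hQ0, MvPolynomial.coeff_zero] at hcoeff
    have := congrArg (fun y : Qb => (y : ℂ)) hcoeff
    simpa [hc'] using this.symm
  · push Not at hk
    exact coeff_eq_zero_of_natDegree_lt ((hD μ).trans_le hk)

end LinIndep

/-! ### 2. Counting: `(n+t choose n)/(n+t+d choose n) → 1` -/

section Counting

/-- `(t+1)ⁿ (n+t+d choose n) ≤ (t+d+1)ⁿ (n+t choose n)`. [folklore] -/
theorem pow_mul_choose_le (n t d : ℕ) :
    (t + 1) ^ n * (n + t + d).choose n ≤ (t + d + 1) ^ n * (n + t).choose n := by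
  induction n with
  | zero => simp
  | succ n ih =>
    -- `(N+1) C(N, n) = C(N+1, n+1) (n+1)`
    have h1 : (n + t + d + 1) * (n + t + d).choose n = (n + 1 + t + d).choose (n + 1) * (n + 1) := by
      have := Nat.add_one_mul_choose_eq (n + t + d) n
      rw [show n + 1 + t + d = n + t + d + 1 by ring]
      exact this
    have h2 : (n + t + 1) * (n + t).choose n = (n + 1 + t).choose (n + 1) * (n + 1) := by
      have := Nat.add_one_mul_choose_eq (n + t) n
      rw [show n + 1 + t = n + t + 1 by ring]
      exact this
    -- compare after multiplying by `n + 1`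
    refine Nat.le_of_mul_le_mul_right ?_ (Nat.succ_pos n)
    have key : (t + 1) * (n + t + d + 1) ≤ (t + d + 1) * (n + t + 1) := by nlinarith
    calc (t + 1) ^ (n + 1) * (n + 1 + t + d).choose (n + 1) * (n + 1)
        = (t + 1) ^ n * (t + 1) * ((n + t + d + 1) * (n + t + d).choose n) := by
          rw [h1, pow_succ]; ring
      _ = (t + 1) * (n + t + d + 1) * ((t + 1) ^ n * (n + t + d).choose n) := by ring
      _ ≤ (t + d + 1) * (n + t + 1) * ((t + d + 1) ^ n * (n + t).choose n) :=
          Nat.mul_le_mul key ih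
      _ = (t + d + 1) ^ n * (t + d + 1) * ((n + t + 1) * (n + t).choose n) := by ring
      _ = (t + d + 1) ^ (n + 1) * (n + 1 + t).choose (n + 1) * (n + 1) := by
          rw [h2, pow_succ]; ring

/-- **Counting lemma**: there is `t` with
`κ · ((n+t+d choose n) - (n+t choose n)) < (n+t+d choose n)`. [folklore] -/
theorem choose_counting (n d κ : ℕ) :
    ∃ t : ℕ, κ * ((n + t + d).choose n - (n + t).choose n) < (n + t + d).choose n := by
  refine ⟨κ * n * d, ?_⟩
  set t := κ * n * d with ht
  set A := (n + t + d).choose n with hA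
  set B := (n + t).choose n with hB
  have hBA : B ≤ A := Nat.choose_le_choose n (by omega)
  have hApos : 0 < A := Nat.choose_pos (by omega)
  have hP := pow_mul_choose_le n t d
  -- pass to `ℝ`
  suffices h : ((κ * (A - B) : ℕ) : ℝ) < (A : ℝ) by exact_mod_cast h
  push_cast [Nat.cast_sub hBA]
  have hPR : ((t : ℝ) + 1) ^ n * A ≤ ((t : ℝ) + d + 1) ^ n * B := by exact_mod_cast hP
  have hs : (0 : ℝ) < (t : ℝ) + d + 1 := by positivity
  -- Bernoulli: `((t+1)/(t+d+1))ⁿ ≥ 1 - n d/(t+d+1)`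
  have hBern : 1 - (n : ℝ) * (d / ((t : ℝ) + d + 1)) ≤ (((t : ℝ) + 1) / ((t : ℝ) + d + 1)) ^ n := by
    have hle1 : (d : ℝ) / ((t : ℝ) + d + 1) ≤ 1 := by
      rw [div_le_one hs]; linarith [(Nat.cast_nonneg t : (0:ℝ) ≤ t)]
    have := one_add_mul_le_pow (a := -((d : ℝ) / ((t : ℝ) + d + 1))) (by linarith) n
    have heq : (1 : ℝ) + -((d : ℝ) / ((t : ℝ) + d + 1)) = ((t : ℝ) + 1) / ((t : ℝ) + d + 1) := by
      field_simp
      ring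
    rw [heq] at this
    linarith
  have hratio : (((t : ℝ) + 1) / ((t : ℝ) + d + 1)) ^ n * A ≤ B := by
    rw [div_pow, div_mul_eq_mul_div, div_le_iff₀ (by positivity)]
    linarith [hPR]
  -- `B ≥ (1 - n d/(t+d+1)) A` and `κ n d < t + d + 1`
  have hκt : (κ : ℝ) * n * d < (t : ℝ) + d + 1 := by
    rw [ht]; push_cast; linarith
  have hA' : (0 : ℝ) < A := by exact_mod_cast hApos
  have hkey : (κ : ℝ) * ((n : ℝ) * (d / ((t : ℝ) + d + 1))) < 1 := by
    rw [← mul_assoc, mul_div_assoc', div_lt_one hs]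
    exact hκt
  nlinarith [mul_le_mul_of_nonneg_right hBern hA'.le, hratio, hkey]

end Counting

/-! ### 3. The rank of the values of the monomials under an algebraic relation -/

section RankBound

variable {K : IntermediateField ℚ ℂ} {n : ℕ}

/-- Homogenisation of `P ∈ K[X₁, …, Xₙ]` in degree `d ≥ deg P`:
`P^h = ∑_ν p_ν X₀^{d-|ν|} X^ν ∈ K[X₀, …, Xₙ]`. [folklore] -/
def homog (P : MvPolynomial (Fin n) K) (d : ℕ) : MvPolynomial (Fin (n + 1)) K :=
  ∑ ν ∈ P.support, MvPolynomial.monomial (Finsupp.cons (d - ν.degree) ν) (MvPolynomial.coeff ν P)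

/-- Degree of a `Finsupp.cons`. [folklore] -/
theorem degree_finsuppCons (y : ℕ) (ν : Fin n →₀ ℕ) : (Finsupp.cons y ν).degree = y + ν.degree := by
  rw [Finsupp.degree_eq_sum, Finsupp.degree_eq_sum, Fin.sum_univ_succ]
  simp [Finsupp.cons_zero, Finsupp.cons_succ]

/-- The homogenisation is homogeneous of degree `d` (for `d ≥ deg P`). [folklore] -/
theorem isHomogeneous_homog (P : MvPolynomial (Fin n) K) {d : ℕ} (hd : P.totalDegree ≤ d) :
    (homog P d).IsHomogeneous d := by
  refine MvPolynomial.IsHomogeneous.sum _ _ _ fun ν hν => ?_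
  refine MvPolynomial.isHomogeneous_monomial _ ?_
  rw [degree_finsuppCons]
  have : ν.degree ≤ d := by
    have h := MvPolynomial.le_totalDegree hν
    rw [Finsupp.degree_apply]
    exact h.trans hd
  omega

/-- Coefficients of the homogenisation. [folklore] -/
theorem coeff_homog (P : MvPolynomial (Fin n) K) (d : ℕ) (ν : Fin n →₀ ℕ) :
    MvPolynomial.coeff (Finsupp.cons (d - ν.degree) ν) (homog P d) = MvPolynomial.coeff ν P := by
  classical
  rw [homog, MvPolynomial.coeff_sum]
  by_cases hν : ν ∈ P.support
  · rw [Finset.sum_eq_single ν]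
    · rw [MvPolynomial.coeff_monomial, if_pos rfl]
    · intro ν' _ hne
      rw [MvPolynomial.coeff_monomial, if_neg]
      intro h
      exact hne (by simpa using congrArg Finsupp.tail h)
    · exact fun h => (h hν).elim
  · rw [MvPolynomial.notMem_support_iff.mp hν]
    refine Finset.sum_eq_zero fun ν' hν' => ?_
    rw [MvPolynomial.coeff_monomial, if_neg]
    intro h
    have : ν' = ν := by simpa using congrArg Finsupp.tail h
    exact hν (this ▸ hν')

/-- The homogenisation of a non-zero polynomial is non-zero. [folklore] -/
theorem homog_ne_zero {P : MvPolynomial (Fin n) K} (hP : P ≠ 0) (d : ℕ) : homog P d ≠ 0 := by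
  obtain ⟨ν, hν⟩ := MvPolynomial.ne_zero_iff.mp hP
  intro h
  have := coeff_homog P d ν
  rw [h, MvPolynomial.coeff_zero] at this
  exact hν this.symm

/-- Evaluation of the homogenisation at `(1, y)` is evaluation of `P` at `y`. [folklore] -/
theorem aeval_cons_one_homog (P : MvPolynomial (Fin n) K) (d : ℕ) (y : Fin n → ℂ) :
    MvPolynomial.aeval (Fin.cons 1 y : Fin (n + 1) → ℂ) (homog P d) = MvPolynomial.aeval y P := by
  conv_rhs => rw [MvPolynomial.as_sum P]
  rw [homog, map_sum, map_sum]
  refine sum_congr rfl fun ν _ => ?_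
  rw [MvPolynomial.aeval_monomial, MvPolynomial.aeval_monomial,
    Finsupp.prod_fintype _ _ (fun i => pow_zero _), Finsupp.prod_fintype _ _ (fun i => pow_zero _),
    Fin.prod_univ_succ]
  simp [Finsupp.cons_zero, Finsupp.cons_succ]

/-- The values `x^μ = ∏ xᵢ^{μᵢ}` of the degree-`m` monomials at a point `x ∈ ℂ^{n+1}`. [folklore] -/
def monVal (x : Fin (n + 1) → ℂ) (m : ℕ) (μ : MonIdx n m) : ℂ :=
  ∏ i, x i ^ μ.1 i

/-- For a homogeneous `R` of degree `m`: `∑_{|μ| = m} coeff_μ(R) · x^μ = R(x)`. [folklore] -/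
theorem sum_coeff_smul_monVal (x : Fin (n + 1) → ℂ) {m : ℕ} (R : MvPolynomial (Fin (n + 1)) K)
    (hR : R.IsHomogeneous m) :
    ∑ μ : MonIdx n m, MvPolynomial.coeff μ.1 R • monVal x m μ = MvPolynomial.aeval x R := by
  classical
  have hsupp : R.support ⊆ (univ : Finset (Fin (n + 1))).finsuppAntidiag m := by
    intro ν hν
    rw [mem_monIdx_iff]
    by_contra hne
    exact (MvPolynomial.mem_support_iff.mp hν) (hR.coeff_eq_zero hne)
  conv_rhs => rw [MvPolynomial.as_sum R, map_sum]
  rw [Finset.sum_subset hsupp (fun ν _ hν => by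
    simp [MvPolynomial.notMem_support_iff.mp hν])]
  rw [← Finset.sum_coe_sort ((univ : Finset (Fin (n + 1))).finsuppAntidiag m)]
  refine sum_congr rfl fun μ _ => ?_
  rw [MvPolynomial.aeval_monomial, Finsupp.prod_fintype _ _ (fun i => pow_zero _), monVal,
    Algebra.smul_def]

/-- **Rank bound under an algebraic relation.** If `P(y) = 0` for a non-zero `P ∈ K[X₁,…,Xₙ]` of
total degree `≤ d ≤ m`, then the `K`-span of the values at `x = (1, y)` of the degree-`m`
monomials in `n + 1` letters has dimension at most `#MonIdx n m - #MonIdx n (m - d)`: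
the evaluation map from the coefficient space `K^{MonIdx n m}` kills the image of multiplication
by the homogenisation `P^h` on `K^{MonIdx n (m-d)}`, which is injective. [folklore] -/
theorem finrank_span_monVal_add_card_le (P : MvPolynomial (Fin n) K) (hP : P ≠ 0) {d m : ℕ}
    (hd : P.totalDegree ≤ d) (hdm : d ≤ m) (y : Fin n → ℂ) (hPy : MvPolynomial.aeval y P = 0) :
    Module.finrank K (Submodule.span K (Set.range (monVal (Fin.cons 1 y) m))) +
      Fintype.card (MonIdx n (m - d)) ≤ Fintype.card (MonIdx n m) := by
  classical
  set x : Fin (n + 1) → ℂ := Fin.cons 1 y with hx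
  set Ph := homog P d with hPh
  have hPhhom : Ph.IsHomogeneous d := isHomogeneous_homog P hd
  have hPh0 : Ph ≠ 0 := homog_ne_zero hP d
  have hPhx : MvPolynomial.aeval x Ph = 0 := by rw [hPh, hx, aeval_cons_one_homog, hPy]
  -- the evaluation map `Φ` and the multiplication map `Ψ`
  set Φ : (MonIdx n m → K) →ₗ[K] ℂ := Fintype.linearCombination K (monVal x m) with hΦ
  set L : (MonIdx n (m - d) → K) →ₗ[K] MvPolynomial (Fin (n + 1)) K :=
    Fintype.linearCombination K fun μ' => MvPolynomial.monomial μ'.1 (1 : K) with hL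
  set Ψ : (MonIdx n (m - d) → K) →ₗ[K] (MonIdx n m → K) :=
    (LinearMap.pi fun μ : MonIdx n m => MvPolynomial.lcoeff K μ.1) ∘ₗ
      (LinearMap.mulRight K Ph) ∘ₗ L with hΨ
  have hLapply : ∀ e, L e = ∑ μ', MvPolynomial.monomial μ'.1 (e μ') := by
    intro e
    rw [hL, Fintype.linearCombination_apply]
    refine sum_congr rfl fun μ' _ => ?_
    rw [MvPolynomial.smul_monomial, smul_eq_mul, mul_one]
  have hLhom : ∀ e, (L e).IsHomogeneous (m - d) := by
    intro e
    rw [hLapply]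
    exact MvPolynomial.IsHomogeneous.sum _ _ _ fun μ' _ =>
      MvPolynomial.isHomogeneous_monomial _ μ'.degree_eq
  have hLPhom : ∀ e, (L e * Ph).IsHomogeneous m := by
    intro e
    have := (hLhom e).mul hPhhom
    rwa [Nat.sub_add_cancel hdm] at this
  have hΨapply : ∀ e μ, Ψ e μ = MvPolynomial.coeff μ.1 (L e * Ph) := by
    intro e μ
    simp [hΨ, MvPolynomial.lcoeff]
  -- `range Ψ ≤ ker Φ`
  have hcomp : ∀ e, Φ (Ψ e) = 0 := by
    intro e
    rw [hΦ, Fintype.linearCombination_apply]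
    simp_rw [hΨapply]
    rw [sum_coeff_smul_monVal x _ (hLPhom e), map_mul, hPhx, mul_zero]
  -- `Ψ` is injective
  have hΨinj : Function.Injective Ψ := by
    rw [← LinearMap.ker_eq_bot, LinearMap.ker_eq_bot']
    intro e he
    have hprod : L e * Ph = 0 := by
      refine MvPolynomial.ext _ _ fun ν => ?_
      rw [MvPolynomial.coeff_zero]
      by_cases hν : ν.degree = m
      · have := congr_fun he ⟨ν, mem_monIdx_iff.mpr hν⟩
        rwa [hΨapply] at this
      · exact (hLPhom e).coeff_eq_zero hν
    have hLe : L e = 0 := (mul_eq_zero.mp hprod).resolve_right hPh0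
    funext μ'
    have := congrArg (MvPolynomial.coeff μ'.1) hLe
    rw [hLapply, MvPolynomial.coeff_sum, Finset.sum_eq_single μ', MvPolynomial.coeff_monomial,
      if_pos rfl, MvPolynomial.coeff_zero] at this
    · exact this
    · intro μ'' _ hne
      rw [MvPolynomial.coeff_monomial, if_neg]
      exact fun h => hne (Subtype.ext h)
    · exact fun h => (h (mem_univ μ')).elim
  -- rank–nullity
  have hrn := LinearMap.finrank_range_add_finrank_ker Φ
  rw [Module.finrank_fintype_fun_eq_card] at hrn
  have hrange : LinearMap.range Φ = Submodule.span K (Set.range (monVal x m)) :=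
    Fintype.range_linearCombination K (monVal x m)
  have hker : Fintype.card (MonIdx n (m - d)) ≤ Module.finrank K (LinearMap.ker Φ) := by
    have h1 : LinearMap.range Ψ ≤ LinearMap.ker Φ := by
      rintro _ ⟨e, rfl⟩
      exact hcomp e
    calc Fintype.card (MonIdx n (m - d)) = Module.finrank K (MonIdx n (m - d) → K) :=
          (Module.finrank_fintype_fun_eq_card K).symm
      _ = Module.finrank K (LinearMap.range Ψ) := (LinearMap.finrank_range_of_inj hΨinj).symm
      _ ≤ Module.finrank K (LinearMap.ker Φ) := Submodule.finrank_mono h1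
  rw [← hrange]
  omega

end RankBound

/-! ### 4. Siegel–Shidlovskii from the rank theorem -/

/-- A polynomial over `ℂ` with coefficients in a subfield `K` comes from `K[X]`. [folklore] -/
theorem exists_map_eq_of_coeff_mem (K : IntermediateField ℚ ℂ) (p : Polynomial ℂ)
    (hp : ∀ k, p.coeff k ∈ K) : ∃ q : Polynomial K, q.map (algebraMap K ℂ) = p := by
  rw [← Polynomial.mem_lifts, Polynomial.lifts_iff_coeff_lifts]
  intro k
  exact ⟨⟨p.coeff k, hp k⟩, rfl⟩

/-- **The rank bound with an arbitrary constant.** The statement of Théorème 5.20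
(`shidlovskii_rankBound`, whose constant is `[K:ℚ]`) with `[K:ℚ]` replaced by any constant `C(K)`
depending only on the number field `K`: `#ι ≤ C(K) · rank_K {Fᵢ(α)}`. Siegel's product trick needs
no more than this (Baker, Ch. 11 §4, works with the cruder constant coming from
`|D| ≫ (r!)^{-(1+16ε)(k-l)d}`), so the reduction below is proved for every `C`;
`shidlovskii_rankBound` is literally `rankBoundWith (fun K => Module.finrank ℚ K)`.
[cite: Rivoal2024, Théorème 5.20] -/
def rankBoundWith (C : IntermediateField ℚ ℂ → ℕ) : Prop :=
  ∀ (K : IntermediateField ℚ ℂ) [FiniteDimensional ℚ K] (ι : Type) [Fintype ι] [DecidableEq ι]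
    (a : ι → ℕ → ℂ), (∀ i, IsStrictEFunction (a i)) → (∀ i n, a i n ∈ K) →
    ∀ (T : Polynomial ℂ) (B : Matrix ι ι (Polynomial ℂ)),
      (∀ k, T.coeff k ∈ K) → (∀ i j k, (B i j).coeff k ∈ K) →
      (∀ i z, T.eval z * deriv (eSeries (a i)) z = ∑ j, (B i j).eval z * eSeries (a j) z) →
      (∀ c : ι → Polynomial ℂ, (∀ i k, (c i).coeff k ∈ K) →
        (∀ z, ∑ i, (c i).eval z * eSeries (a i) z = 0) → c = 0) →
      ∀ α : ℂ, α ∈ K → α ≠ 0 → T.eval α ≠ 0 →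
        Fintype.card ι ≤ C K *
          Module.finrank K (Submodule.span K (Set.range fun i => eSeries (a i) α))

/-- `shidlovskii_rankBound` is the rank bound with constant `[K:ℚ]`. [cite: Rivoal2024, Théorème 5.20] -/
theorem shidlovskii_rankBound_iff_rankBoundWith :
    shidlovskii_rankBound ↔ rankBoundWith fun K => Module.finrank ℚ K :=
  Iff.rfl

/-- **Siegel–Shidlovskii (Rivoal Thm. 5.10, algebraic-independence form) from a rank bound with
any constant `C(K)`** — the printed reduction by Siegel's product trick (Rivoal pp. 240–241;
Baker Ch. 11 §4), PROVED. [cite: Rivoal2024, §5.3 pp. 240–241] -/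
theorem siegelShidlovskii_algIndep_of_rankBoundWith (C : IntermediateField ℚ ℂ → ℕ)
    (h520 : rankBoundWith C) : siegelShidlovskii_algIndep := by
  classical
  intro n a ha T B hT hB hsys halg α hα hα0 hTα
  set Qb := algebraicClosure ℚ ℂ with hQb
  -- `n = 0`
  rcases Nat.eq_zero_or_pos n with rfl | hn
  · exact (algebraicIndependent_empty_type_iff).mpr (algebraMap Qb ℂ).injective
  by_contra hdep
  -- a non-trivial algebraic relation over `ℚ̄`
  obtain ⟨P, hP0, hPval⟩ : ∃ P : MvPolynomial (Fin n) Qb, P ≠ 0 ∧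
      MvPolynomial.aeval (fun i => eSeries (a i) α) P = 0 := by
    have : ¬ Function.Injective (MvPolynomial.aeval (R := Qb) fun i => eSeries (a i) α) := hdep
    rw [injective_iff_map_eq_zero] at this
    push Not at this
    obtain ⟨P, h1, h2⟩ := this
    exact ⟨P, h2, h1⟩
  -- the number field `K`
  have hexp : ∀ i, ExpBound (a i) := fun i => (ha i).expBound
  choose S hS using fun i => (ha i).exists_finset_adjoin
  set ST : Finset ℂ := (range (T.natDegree + 1)).image T.coeff with hST
  set SB : Finset ℂ := (univ : Finset (Fin n × Fin n)).biUnion fun q =>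
    (range ((B q.1 q.2).natDegree + 1)).image (B q.1 q.2).coeff with hSB
  set SP : Finset ℂ := P.support.image fun ν => ((MvPolynomial.coeff ν P : Qb) : ℂ) with hSP
  set Sall : Finset ℂ := insert α (ST ∪ SB ∪ SP ∪ univ.biUnion S) with hSall
  have halgS : ∀ x ∈ Sall, IsAlgebraic ℚ x := by
    intro x hx
    rw [hSall, mem_insert] at hx
    rcases hx with rfl | hx
    · exact hα
    rcases mem_union.mp hx with hx | hx
    · rcases mem_union.mp hx with hx | hx
      · rcases mem_union.mp hx with hx | hx
        · obtain ⟨k, -, rfl⟩ := mem_image.mp hx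
          exact hT k
        · obtain ⟨q, -, hq⟩ := mem_biUnion.mp hx
          obtain ⟨k, -, rfl⟩ := mem_image.mp hq
          exact hB q.1 q.2 k
      · obtain ⟨ν, -, rfl⟩ := mem_image.mp hx
        exact mem_algebraicClosure_iff.mp (SetLike.coe_mem _)
    · obtain ⟨i, -, hi⟩ := mem_biUnion.mp hx
      exact (hS i).1 x hi
  set K : IntermediateField ℚ ℂ := IntermediateField.adjoin ℚ (Sall : Set ℂ) with hKdef
  haveI : Finite ↥(Sall : Set ℂ) := Sall.finite_toSet.to_subtype
  haveI : FiniteDimensional ℚ K :=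
    IntermediateField.finiteDimensional_adjoin fun x hx => (halgS x (by exact_mod_cast hx)).isIntegral
  have hKQ : K ≤ Qb := by
    rw [hKdef, IntermediateField.adjoin_le_iff]
    intro x hx
    exact mem_algebraicClosure_iff.mpr (halgS x (by exact_mod_cast hx))
  have hKalg : ∀ x ∈ K, IsAlgebraic ℚ x := fun x hx => mem_algebraicClosure_iff.mp (hKQ hx)
  have hSK : ∀ x ∈ Sall, x ∈ K := fun x hx => IntermediateField.subset_adjoin ℚ _ (by exact_mod_cast hx)
  -- memberships
  have hαK : α ∈ K := hSK α (by simp [hSall])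
  have hTK : ∀ k, T.coeff k ∈ K := by
    intro k
    by_cases hk : k ≤ T.natDegree
    · exact hSK _ (by
        rw [hSall]
        refine mem_insert_of_mem (mem_union_left _ (mem_union_left _ (mem_union_left _ ?_)))
        exact mem_image_of_mem _ (mem_range.mpr (Nat.lt_succ_of_le hk)))
    · rw [coeff_eq_zero_of_natDegree_lt (lt_of_not_ge hk)]
      exact zero_mem K
  have hBK : ∀ i j k, (B i j).coeff k ∈ K := by
    intro i j k
    by_cases hk : k ≤ (B i j).natDegree
    · exact hSK _ (by
        rw [hSall]
        refine mem_insert_of_mem (mem_union_left _ (mem_union_left _ (mem_union_right _ ?_)))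
        exact mem_biUnion.mpr ⟨(i, j), mem_univ _,
          mem_image_of_mem _ (mem_range.mpr (Nat.lt_succ_of_le hk))⟩)
    · rw [coeff_eq_zero_of_natDegree_lt (lt_of_not_ge hk)]
      exact zero_mem K
  have haK : ∀ i k, a i k ∈ K := by
    intro i k
    have h1 : IntermediateField.adjoin ℚ (S i : Set ℂ) ≤ K := by
      rw [hKdef]
      refine IntermediateField.adjoin.mono ℚ _ _ fun x hx => ?_
      have hx' : x ∈ S i := by exact_mod_cast hx
      have : x ∈ Sall := by
        rw [hSall]
        exact mem_insert_of_mem (mem_union_right _ (mem_biUnion.mpr ⟨i, mem_univ _, hx'⟩))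
      exact_mod_cast this
    exact h1 ((hS i).2 k)
  have hPK : ∀ ν, ((MvPolynomial.coeff ν P : Qb) : ℂ) ∈ K := by
    intro ν
    by_cases hν : ν ∈ P.support
    · exact hSK _ (by
        rw [hSall]
        exact mem_insert_of_mem (mem_union_left _ (mem_union_right _ (mem_image_of_mem _ hν))))
    · rw [MvPolynomial.notMem_support_iff.mp hν]
      simp
  -- lift `T`, `B`, `P` to `K`
  obtain ⟨TK, hTK'⟩ := exists_map_eq_of_coeff_mem K T hTK
  have hBex : ∀ i j, ∃ q : Polynomial K, q.map (algebraMap K ℂ) = B i j :=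
    fun i j => exists_map_eq_of_coeff_mem K (B i j) (hBK i j)
  choose BK hBK' using hBex
  have hTK0 : TK ≠ 0 := by
    rintro rfl
    rw [Polynomial.map_zero] at hTK'
    rw [← hTK'] at hTα
    simp at hTα
  have hsysK : ∀ i z, aeval z TK * deriv (eSeries (a i)) z = ∑ j, aeval z (BK i j) * eSeries (a j) z := by
    intro i z
    have := hsys i z
    simp only [← hTK', ← hBK', eval_map_algebraMap] at this
    exact this
  set y : Fin n → ℂ := fun i => eSeries (a i) α with hy
  set PK : MvPolynomial (Fin n) K :=
    ∑ ν ∈ P.support, MvPolynomial.monomial ν ⟨((MvPolynomial.coeff ν P : Qb) : ℂ), hPK ν⟩ with hPKdef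
  have hPK0 : PK ≠ 0 := by
    obtain ⟨ν, hν⟩ := MvPolynomial.ne_zero_iff.mp hP0
    have hνs : ν ∈ P.support := MvPolynomial.mem_support_iff.mpr hν
    intro h0
    have hc : MvPolynomial.coeff ν PK = ⟨((MvPolynomial.coeff ν P : Qb) : ℂ), hPK ν⟩ := by
      rw [hPKdef, MvPolynomial.coeff_sum, Finset.sum_eq_single ν]
      · rw [MvPolynomial.coeff_monomial, if_pos rfl]
      · intro ν' _ hne
        rw [MvPolynomial.coeff_monomial, if_neg hne]
      · exact fun h => (h hνs).elim
    rw [h0, MvPolynomial.coeff_zero] at hc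
    have := congrArg (fun t : K => (t : ℂ)) hc
    simp only [ZeroMemClass.coe_zero] at this
    exact hν (by exact_mod_cast this.symm)
  have hPKy : MvPolynomial.aeval y PK = 0 := by
    have h1 : MvPolynomial.aeval y PK =
        ∑ ν ∈ P.support, ((MvPolynomial.coeff ν P : Qb) : ℂ) * ∏ i, y i ^ ν i := by
      rw [hPKdef, map_sum]
      refine sum_congr rfl fun ν _ => ?_
      rw [MvPolynomial.aeval_monomial, Finsupp.prod_fintype _ _ (fun i => pow_zero _)]
      rfl
    have h2 : MvPolynomial.aeval y P =
        ∑ ν ∈ P.support, ((MvPolynomial.coeff ν P : Qb) : ℂ) * ∏ i, y i ^ ν i := by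
      conv_lhs => rw [MvPolynomial.as_sum P]
      rw [map_sum]
      refine sum_congr rfl fun ν _ => ?_
      rw [MvPolynomial.aeval_monomial, Finsupp.prod_fintype _ _ (fun i => pow_zero _)]
      rfl
    rw [h1, ← h2, hPval]
  -- parameters
  set d := PK.totalDegree with hd
  set κ := C K with hκ
  obtain ⟨t, ht⟩ := choose_counting n d κ
  set m := t + d with hm
  -- Théorème 5.20 for the degree-`m` monomials
  set f : MonIdx n m → ℕ → ℂ := fun μ => emon a μ.1 with hf
  have hfexp : ∀ μ, ExpBound (f μ) := fun μ => expBound_emon hexp μ.1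
  set CK := monMatrix (extMatrix BK) m with hCK
  have hsysM : ∀ (μ : MonIdx n m) z, aeval z TK * deriv (eSeries (f μ)) z =
      ∑ ν, aeval z (CK μ ν) * eSeries (f ν) z := fun μ z => emon_system hexp TK BK hsysK m μ z
  have hstrict : ∀ μ, IsStrictEFunction (f μ) := fun μ =>
    (isArithE_emon (fun i => (ha i).isArithE) μ.1).isStrictEFunction
      (exists_ode_of_system hKalg f hfexp TK hTK0 CK hsysM μ)
  have hfK : ∀ μ k, f μ k ∈ K := fun μ k => emon_mem K haK μ.1 k
  set T' : Polynomial ℂ := TK.map (algebraMap K ℂ) with hT'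
  set B' : Matrix (MonIdx n m) (MonIdx n m) (Polynomial ℂ) := fun μ ν => (CK μ ν).map (algebraMap K ℂ)
    with hB'
  have hT'K : ∀ k, T'.coeff k ∈ K := fun k => by rw [hT', coeff_map]; exact SetLike.coe_mem _
  have hB'K : ∀ μ ν k, (B' μ ν).coeff k ∈ K := fun μ ν k => by rw [hB', coeff_map]; exact SetLike.coe_mem _
  have hsys' : ∀ μ z, T'.eval z * deriv (eSeries (f μ)) z = ∑ ν, (B' μ ν).eval z * eSeries (f ν) z := by
    intro μ z
    simp only [hT', hB', eval_map_algebraMap]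
    exact hsysM μ z
  have hli : ∀ c : MonIdx n m → Polynomial ℂ, (∀ μ k, (c μ).coeff k ∈ K) →
      (∀ z, ∑ μ, (c μ).eval z * eSeries (f μ) z = 0) → c = 0 :=
    fun c hc hrel => emon_linIndep_of_algebraicIndependent hexp halg K hKQ c hc hrel
  have hT'α : T'.eval α ≠ 0 := by rw [hTK']; exact hTα
  have h520m := h520 K (MonIdx n m) f hstrict hfK T' B' hT'K hB'K hsys' hli α hαK hα0 hT'α
  -- the values of the monomials are the `monVal` at `(1, F(α))`
  have hval : (fun μ : MonIdx n m => eSeries (f μ) α) = monVal (Fin.cons 1 y) m := by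
    funext μ
    rw [hf, monVal, eSeries_emon hexp]
    refine Finset.prod_congr rfl fun i _ => ?_
    congr 1
    refine Fin.cases ?_ (fun i => ?_) i
    · rw [eSeries_extFamily_zero, Fin.cons_zero]
    · rw [extFamily_succ, Fin.cons_succ]
  rw [hval] at h520m
  -- the rank bound from the relation `PK(y) = 0`
  have hdm : d ≤ m := by rw [hm]; exact Nat.le_add_left d t
  have hrank := finrank_span_monVal_add_card_le PK hPK0 le_rfl hdm y hPKy
  -- counting
  have hcm : Fintype.card (MonIdx n m) = (n + t + d).choose n := by
    rw [card_monIdx, hm, ← Nat.add_assoc]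
    exact Nat.choose_symm_of_eq_add (by ring)
  have hct : Fintype.card (MonIdx n (m - d)) = (n + t).choose n := by
    rw [card_monIdx, hm, Nat.add_sub_cancel]
    exact Nat.choose_symm_of_eq_add (by ring)
  rw [hcm] at h520m hrank
  rw [hct] at hrank
  have h1 : (n + t + d).choose n ≤ κ * ((n + t + d).choose n - (n + t).choose n) := by
    calc (n + t + d).choose n ≤ κ * Module.finrank K
          (Submodule.span K (Set.range (monVal (Fin.cons 1 y) m))) := h520m
      _ ≤ κ * ((n + t + d).choose n - (n + t).choose n) := by
          apply Nat.mul_le_mul_left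
          omega
  exact absurd ht (not_lt.mpr h1)

/-- **Siegel–Shidlovskii (Rivoal Thm. 5.10, algebraic-independence form) from Shidlovskii's rank
theorem (Rivoal Thm. 5.20)**: the named fact `siegelShidlovskii_algIndep` (= the catalogue
declaration `EFunctionValuesAtAlgebraicPoints`) follows from the named fact
`shidlovskii_rankBound` — so its discharge is reduced to `theorem shidlovskii_rankBound_holds`.
PROVED. [cite: Rivoal2024, §5.3 pp. 240–241] -/
theorem siegelShidlovskii_algIndep_of_rankBound (h520 : shidlovskii_rankBound) :
    siegelShidlovskii_algIndep :=
  siegelShidlovskii_algIndep_of_rankBoundWith (fun K => Module.finrank ℚ K) h520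

/-- The same for the catalogue declaration. [cite: Rivoal2024, Théorème 5.10] -/
theorem eFunctionValuesAtAlgebraicPoints_of_rankBound (h520 : shidlovskii_rankBound) :
    EFunctionValuesAtAlgebraicPoints :=
  eFunctionValuesAtAlgebraicPoints_iff.mpr (siegelShidlovskii_algIndep_of_rankBound h520)

end Literature.Barriers.Schanuel

end
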